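import Summits.QuantumFields.BalabanUV.T4Continuum.Spine.NE2BalabanConstWitness
import Summits.QuantumFields.BalabanUV.T4Continuum.Support.LatticeCosineProfile

/-!
# T⁴ programme, spine node NE2 (U1a), tier B rows B5 × B6 × B7 — AN `x`-DEPENDENT WITNESS FOR ROOT B's END:
# the transverse abelian wave `R^{(k)}_{ν₀}(x) = exp((θ/n_k)·cos(2π x_{μ₀})·A)`, `R^{(k)}_ν ≡ 1` (`ν ≠ ν₀`), lies in row B5's class with a NON-ZERO
# lattice-Lipschitz size, satisfies node NE3's hypothesis SHAPE with rate `L^{−k}` ACROSS THE BLOCK HIERARCHY, and ROOT B's END fires for it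

NE2 formalisation swarm, leaf prover 03 (row B5 lineage; support row «B7.w END WITNESS», third file; INTENT CLAIMS.log l.9054).
`Spine/NE2BalabanFlatWitness` (p212801) and `Spine/NE2BalabanConstWitness` (p213007) inhabit the antecedent of ROOT B's END
`NE2BalabanThreshold.balaban_final_rate_of_regular` with backgrounds CONSTANT in `x` (lattice-Lipschitz budget `β = 0`, two-level consistency
without moving across sites).  This file adds a background VARYING along a transverse coordinate `μ₀ ≠ ν₀`:
  `waveRg A θ ν₀ μ₀ : R^{(k)}_{ν₀}(x) = exp((θ·cos(2π·val(x_{μ₀})/(n_k·M_{μ₀}))/n_k · A)`, `R^{(k)}_ν(x) = 1` (`ν ≠ ν₀`), `n_k = L^k`, `‖A‖ ≤ 1`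
(the profile is a smooth periodic function of the PHYSICAL coordinate `val(x_{μ₀})/n_k`, read at every level on its own lattice):
 * §1 lattice trigonometry `cang m a = cos(2π·val(a)/m)` on `ZMod m`: one lattice step moves it by `≤ 2π/m` (`abs_cang_add_one_sub_le`, wrap-around
   included) and THE BLOCK PARENT by `≤ 2π/(n·M_{μ₀})` (`abs_cang_sub_cang_par_le`, via the owner's `BalabanAveragedTowerModes.val_par`:
   `val(par x′) = ⌊val(x′)/L⌋`) — the parent∕child site geometry of the B6 reading (`NE2FromNE3.pt`, `BlockPairingGeometry.parT`) exercised by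
   `x`-dependent data;
 * §2 readings `connTower_wave_self∕_ne`, `dconnTower_wave` (`D_νw_ν = 0`: the wave is transverse), `norm_wexp_sub_wexp_le`;
 * §3 **`regularTransporters_wave`**: the (3.35)-shape class with `α = |θ| + θ²` and the NON-TRIVIAL Lipschitz budget `βw = 2θ² + 2π|θ|/M_{μ₀}`;
   `waveRg_zero_ne_one` (not the flat background);
 * §4 **`localRate_wave`**: `LocalRate (bgReadings (regClass (liftR (waveRg …)))) βw L⁻¹` through the owner's faithful adapter
   `NE2FromNE3.localRate_of_consistent` — child and parent readings differ by `O(n_k⁻¹)` BECAUSE the blocks nest;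
 * §5 **`balaban_final_rate_wave`** (binders `hL`, `hd`, `ha′`, `‖A‖ ≤ 1`, `ν₀ ≠ μ₀`, `|θ| + θ² ≤ η⋆`, `βw ≤ η⋆`) and the unconditional instance
   **`balaban_final_rate_wave_at`** at `θw = η⋆/(2 + 2π/M_{μ₀})` (`thetaW_small`, `waveRg_at_zero_ne_one`).

HONEST FRAMING (T4-DAG p. 1).  A TOY member of the data class (transverse abelian-type wave with colour generator `A`; OURS); finite-dimensional
algebra, the exponential's second-order remainder and `|cos a − cos b| ≤ |a − b|`; asserts NOTHING about Bałaban's minimisers `U_k(V)` (no B0,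
c5) and nothing about node NE3 away from this family; ROOT B for general data stays CONDITIONAL on node NE3 (OPEN) and on row B5's class;
GLOBAL small field; finite torus, linear layer, operator norm; NOT [B9] (3.23)–(3.26) as printed; NE2 (U1a) is NOT PROVED by this file (c1
with the carver); spine PROVED 0/9 unchanged; NOT infinite volume, NOT a mass gap, NOT Clay, NOT summit progress.  HONEST DEPENDENCY: continuum
YM on T⁴ ⇐ BetaPertH ∧ nine spine estimates (0/9 proved); BetaPertH ⇐ (D1) ∧ (D4) ∧ CAP+tail; G-an2-4 gates asym, D1 and NE2/3/4.  ABSOLUTE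
RULE: no internally-minted statement enters as a cited fact; no `[cite:]` tag is used as a fact; no `def … : Prop` fact; no `sorry`.
-/

noncomputable section

open scoped BigOperators ComplexConjugate Matrix Matrix.Norms.L2Operator Kronecker
open Filter Topology NormedSpace Real

namespace Summit.QuantumFields.BalabanUV.T4Continuum.NE2BalabanWaveWitness

open Literature.MathematicalPhysics.QuantumFieldTheory.Balaban1983to89.B5Prop11Plancherel (Cst Cst_nonneg Tor fine unitVec)
open Literature.MathematicalPhysics.QuantumFieldTheory.Balaban1983to89.B5G183RateUnitTower (lev lev_neZero)
open Literature.MathematicalPhysics.QuantumFieldTheory.Balaban1983to89.T4EtaRateMin (LocalRate)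
open Summit.QuantumFields.BalabanUV.T4Continuum
open Summit.QuantumFields.BalabanUV.T4Continuum.CovariantAveragingTower (TowerLimitRate)
open Summit.QuantumFields.BalabanUV.T4Continuum.BalabanAveragedTowerUnit (idx Qlev one_le_lev' lev_succ' cast_lev')
open Summit.QuantumFields.BalabanUV.T4Continuum.BalabanAveragedTowerModes (par val_par)
open Summit.QuantumFields.BalabanUV.T4Continuum.BackgroundResolventTower
open Summit.QuantumFields.BalabanUV.T4Continuum.BlockPairingGeometry (tau parT)
open Summit.QuantumFields.BalabanUV.T4Continuum.AbelianCovariantLaplacian (tauInv)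
open Summit.QuantumFields.BalabanUV.T4Continuum.KingPairingPlantedLaw
open Summit.QuantumFields.BalabanUV.T4Continuum.GramPerturbationLaw (C2gram)
open Summit.QuantumFields.BalabanUV.T4Continuum.NE2FromNE3 (bgReadings localRate_of_consistent)
open Summit.QuantumFields.BalabanUV.T4Continuum.RegularBackgroundTower (RegularTransporters connTower dconnTower regClass betaNE3 lev_pos)
open Summit.QuantumFields.BalabanUV.T4Continuum.GaugeTermScalarData (QuT Q1)
open Summit.QuantumFields.BalabanUV.T4Continuum.RegularSiteTransporters (siteT)
open Summit.QuantumFields.BalabanUV.T4Continuum.NestedContourTransport (theta0)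
open Summit.QuantumFields.BalabanUV.T4Continuum.NE2BalabanRoot (balabanPert)
open Summit.QuantumFields.BalabanUV.T4Continuum.NE2BalabanGauge (gaugeSlot liftR)
open Summit.QuantumFields.BalabanUV.T4Continuum.NE2BalabanLayerSharp (kappaBs C2Bs KstarR)
open Summit.QuantumFields.BalabanUV.T4Continuum.NE2BalabanWiring (epsR CdeltaR)
open Summit.QuantumFields.BalabanUV.T4Continuum.NE2BalabanFinal (kappa4F C4F)
open Summit.QuantumFields.BalabanUV.T4Continuum.NE2BalabanThreshold (etaStar etaStar_pos balaban_final_rate_of_regular)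
open Summit.QuantumFields.BalabanUV.T4Continuum.NE2BalabanConstWitness
open Summit.QuantumFields.BalabanUV.T4Continuum.LatticeCosineProfile

/-! ## §1 (moved) Lattice trigonometry lives in `Support/LatticeCosineProfile` (`cang`, `abs_cang_add_one_sub_le`, `abs_cang_sub_cang_par_le`) -/

/-! ## §2 The transverse wave background and its readings -/

/-- **THE TRANSVERSE WAVE BACKGROUND** `R^{(k)}_{ν₀}(x) = exp((θ·c_k(x)/n_k)·A)`, `c_k(x) = cos(2π·val(x_{μ₀})/(n_k M_{μ₀}))`, and `R^{(k)}_ν(x) = 1` for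
`ν ≠ ν₀` (site-based bond transporters; a TOY member of the data class, OURS — no relation to Bałaban's minimisers is asserted). [folklore] -/
def waveRg {d : ℕ} (L : ℕ) (M : Fin d → ℕ) {o : Type*} [Fintype o] [DecidableEq o] (A : Matrix o o ℂ) (θ : ℝ) (ν₀ μ₀ : Fin d) :
    (k : ℕ) → Fin d → (Tor (fine (lev L k) M) → Matrix o o ℂ) :=
  fun k ν x => if ν = ν₀ then uexp L (θ * cang (fine (lev L k) M μ₀) (x μ₀)) A k else 1

variable {d : ℕ} (L : ℕ) [NeZero L] (M : Fin d → ℕ) [hM : ∀ μ, NeZero (M μ)] (a : ℝ) (ha : 0 < a)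
variable {o : Type*} [Fintype o] [DecidableEq o]
variable (A : Matrix o o ℂ) (θ : ℝ) (ν₀ μ₀ : Fin d)

omit [NeZero L] hM in
/-- the wave in its own direction. [folklore] -/
theorem waveRg_self (k : ℕ) (x : Tor (fine (lev L k) M)) :
    waveRg L M A θ ν₀ μ₀ k ν₀ x = uexp L (θ * cang (fine (lev L k) M μ₀) (x μ₀)) A k := if_pos rfl

omit [NeZero L] hM in
/-- the other directions carry the identity. [folklore] -/
theorem waveRg_ne {ν : Fin d} (hν : ν ≠ ν₀) (k : ℕ) (x : Tor (fine (lev L k) M)) : waveRg L M A θ ν₀ μ₀ k ν x = 1 := if_neg hν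

omit [NeZero L] hM in
/-- the connection reading in direction `ν₀`: `w^{(k)}_{ν₀}(x, κ) = w_k(θ·c_k(x), A)`. [folklore] -/
theorem connTower_wave_self (k : ℕ) (i : idx L M k) :
    connTower L M (liftR L M (waveRg L M A θ ν₀ μ₀)) k ν₀ i = wexp L (θ * cang (fine (lev L k) M μ₀) (i.1 μ₀)) A k := by
  show ((lev L k : ℕ) : ℂ) • (waveRg L M A θ ν₀ μ₀ k ν₀ i.1 - 1) = _
  rw [waveRg_self]; rfl

omit [NeZero L] hM in
/-- the connection reading vanishes in the other directions. [folklore] -/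
theorem connTower_wave_ne {ν : Fin d} (hν : ν ≠ ν₀) (k : ℕ) (i : idx L M k) :
    connTower L M (liftR L M (waveRg L M A θ ν₀ μ₀)) k ν i = 0 := by
  show ((lev L k : ℕ) : ℂ) • (waveRg L M A θ ν₀ μ₀ k ν i.1 - 1) = 0
  rw [waveRg_ne L M A θ ν₀ μ₀ hν, sub_self, smul_zero]

omit [NeZero L] hM in
/-- a backward step in direction `ν₀ ≠ μ₀` does not move the transverse coordinate. [folklore] -/
theorem tauInv_transverse {ν₀ μ₀ : Fin d} (hνμ : ν₀ ≠ μ₀) (k : ℕ) (i : idx L M k) :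
    (tauInv (fine (lev L k) M) ν₀ i).1 μ₀ = i.1 μ₀ := by
  show (i.1 - unitVec (fine (lev L k) M) ν₀) μ₀ = i.1 μ₀
  rw [Pi.sub_apply, unitVec, Pi.single_eq_of_ne hνμ.symm, sub_zero]

omit [NeZero L] hM in
/-- **THE WAVE IS TRANSVERSE**: its lattice-derivative tower `D_νw^{(k)}_ν` vanishes (`ν₀ ≠ μ₀`). [folklore] -/
theorem dconnTower_wave (hνμ : ν₀ ≠ μ₀) (k : ℕ) (ν : Fin d) (i : idx L M k) :
    dconnTower L M (liftR L M (waveRg L M A θ ν₀ μ₀)) k ν i = 0 := by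
  by_cases hν : ν = ν₀
  · subst hν
    rw [dconnTower, connTower_wave_self, connTower_wave_self, tauInv_transverse L M hνμ, sub_self, smul_zero]
  · rw [dconnTower, connTower_wave_ne L M A θ ν₀ μ₀ hν, connTower_wave_ne L M A θ ν₀ μ₀ hν, sub_self, smul_zero]

omit hM in
/-- **THE ONE-STEP ESTIMATE** for readings with two profile values `c, c′ ∈ [−1, 1]` at two levels `n, n′`:
`‖w_{k′}(θc′) − w_k(θc)‖ ≤ θ²/n_{k′} + θ²/n_k + |θ|·|c′ − c|` (`|θ| ≤ 1`, `‖A‖ ≤ 1`). [folklore] -/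
theorem norm_wexp_sub_wexp_le {A : Matrix o o ℂ} (hA : ‖A‖ ≤ 1) {θ : ℝ} (hθ : |θ| ≤ 1) {c c' : ℝ} (hc : |c| ≤ 1) (hc' : |c'| ≤ 1)
    (k k' : ℕ) :
    ‖wexp L (θ * c') A k' - wexp L (θ * c) A k‖
      ≤ θ ^ 2 / ((lev L k' : ℕ) : ℝ) + θ ^ 2 / ((lev L k : ℕ) : ℝ) + |θ| * |c' - c| := by
  have hθc : |θ * c| ≤ 1 := by rw [abs_mul]; nlinarith [abs_nonneg θ, abs_nonneg c]
  have hθc' : |θ * c'| ≤ 1 := by rw [abs_mul]; nlinarith [abs_nonneg θ, abs_nonneg c']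
  have h1 := norm_wexp_sub_le L hθc' hA k'
  have h0 := norm_wexp_sub_le L hθc hA k
  have hn := one_le_cast_lev L k
  have hn' := one_le_cast_lev L k'
  have hc2 : c ^ 2 ≤ 1 := sq_le_one_iff_abs_le_one _ |>.mpr hc
  have hc2' : c' ^ 2 ≤ 1 := sq_le_one_iff_abs_le_one _ |>.mpr hc'
  have hsq' : (θ * c') ^ 2 / ((lev L k' : ℕ) : ℝ) ≤ θ ^ 2 / ((lev L k' : ℕ) : ℝ) := by
    refine div_le_div_of_nonneg_right ?_ (by linarith)
    rw [mul_pow]; exact mul_le_of_le_one_right (sq_nonneg θ) hc2'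
  have hsq : (θ * c) ^ 2 / ((lev L k : ℕ) : ℝ) ≤ θ ^ 2 / ((lev L k : ℕ) : ℝ) := by
    refine div_le_div_of_nonneg_right ?_ (by linarith)
    rw [mul_pow]; exact mul_le_of_le_one_right (sq_nonneg θ) hc2
  have hmid : ‖((θ * c' : ℝ) : ℂ) • A - ((θ * c : ℝ) : ℂ) • A‖ ≤ |θ| * |c' - c| := by
    rw [← sub_smul, ← Complex.ofReal_sub, norm_smul, Complex.norm_real, Real.norm_eq_abs, ← mul_sub, abs_mul]
    exact mul_le_of_le_one_right (by positivity) hA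
  calc ‖wexp L (θ * c') A k' - wexp L (θ * c) A k‖
      = ‖(wexp L (θ * c') A k' - ((θ * c' : ℝ) : ℂ) • A) + (((θ * c' : ℝ) : ℂ) • A - ((θ * c : ℝ) : ℂ) • A)
          - (wexp L (θ * c) A k - ((θ * c : ℝ) : ℂ) • A)‖ := by congr 1; abel
    _ ≤ ‖wexp L (θ * c') A k' - ((θ * c' : ℝ) : ℂ) • A‖ + ‖((θ * c' : ℝ) : ℂ) • A - ((θ * c : ℝ) : ℂ) • A‖
          + ‖wexp L (θ * c) A k - ((θ * c : ℝ) : ℂ) • A‖ := by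
        exact (norm_sub_le _ _).trans (add_le_add (norm_add_le _ _) le_rfl)
    _ ≤ θ ^ 2 / ((lev L k' : ℕ) : ℝ) + |θ| * |c' - c| + θ ^ 2 / ((lev L k : ℕ) : ℝ) :=
        add_le_add (add_le_add (h1.trans hsq') hmid) (h0.trans hsq)
    _ = θ ^ 2 / ((lev L k' : ℕ) : ℝ) + θ ^ 2 / ((lev L k : ℕ) : ℝ) + |θ| * |c' - c| := by ring

omit [NeZero L] in
/-- `n_k·(u′ − u) = w′ − w` for two transporters at the same level. [folklore] -/
theorem smul_uexp_sub_uexp (t t' : ℝ) (A : Matrix o o ℂ) (k : ℕ) :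
    ((lev L k : ℕ) : ℂ) • (uexp L t' A k - uexp L t A k) = wexp L t' A k - wexp L t A k := by
  rw [wexp, wexp, ← smul_sub, sub_sub_sub_cancel_right]

/-! ## §3 The wave lies in row B5's class with a non-trivial Lipschitz budget -/

/-- the lattice-Lipschitz ∕ consistency budget of the wave: `βw = 2θ² + 2π|θ|/M_{μ₀}`. [folklore] -/
def betaW (M : Fin d → ℕ) (θ : ℝ) (μ₀ : Fin d) : ℝ := 2 * θ ^ 2 + 2 * π * |θ| / (M μ₀ : ℝ)

omit [NeZero L] hM in
/-- `0 ≤ βw`. [folklore] -/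
theorem betaW_nonneg : 0 ≤ betaW M θ μ₀ := by unfold betaW; positivity

/-- **ROW B5's CLASS IS POPULATED BY `x`-DEPENDENT DATA**: for `‖A‖ ≤ 1`, `|θ| ≤ 1` the transverse wave lies in the (3.35)-shape class with
`α = |θ| + θ²` and the NON-TRIVIAL lattice-Lipschitz budget `β = 2θ² + 2π|θ|/M_{μ₀}` (one transverse lattice step moves the profile by
`≤ 2π/(n_k M_{μ₀})`). [folklore] -/
theorem regularTransporters_wave {A : Matrix o o ℂ} (hA : ‖A‖ ≤ 1) {θ : ℝ} (hθ : |θ| ≤ 1) (ν₀ μ₀ : Fin d) :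
    RegularTransporters L M (liftR L M (waveRg L M A θ ν₀ μ₀)) (|θ| + θ ^ 2) (betaW M θ μ₀) where
  nonneg := ⟨by positivity, betaW_nonneg M θ μ₀⟩
  size k ν i := by
    show ‖((lev L k : ℕ) : ℂ) • (waveRg L M A θ ν₀ μ₀ k ν i.1 - 1)‖ ≤ |θ| + θ ^ 2
    by_cases hν : ν = ν₀
    · subst hν
      rw [waveRg_self]
      set c := cang (fine (lev L k) M μ₀) (i.1 μ₀) with hc
      have hc1 : |c| ≤ 1 := abs_cang_le _ _
      have hθc : |θ * c| ≤ 1 := by rw [abs_mul]; nlinarith [abs_nonneg θ, abs_nonneg c]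
      refine (norm_wexp_le L hθc hA k).trans ?_
      rw [abs_mul, mul_pow]
      have hc2 : c ^ 2 ≤ 1 := sq_le_one_iff_abs_le_one _ |>.mpr hc1
      exact add_le_add (mul_le_of_le_one_right (abs_nonneg θ) hc1) (mul_le_of_le_one_right (sq_nonneg θ) hc2)
    · rw [waveRg_ne L M A θ ν₀ μ₀ hν, sub_self, smul_zero, norm_zero]; positivity
  lipschitz k ν μ i := by
    have hn0 : (0 : ℝ) < ((lev L k : ℕ) : ℝ) := lev_pos L k
    show ‖((lev L k : ℕ) : ℂ) • (waveRg L M A θ ν₀ μ₀ k ν (i.1 + unitVec (fine (lev L k) M) μ) - waveRg L M A θ ν₀ μ₀ k ν i.1)‖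
      ≤ betaW M θ μ₀ / (lev L k : ℕ)
    by_cases hν : ν = ν₀
    · subst hν
      rw [waveRg_self, waveRg_self, smul_uexp_sub_uexp]
      set c := cang (fine (lev L k) M μ₀) (i.1 μ₀) with hc
      set c' := cang (fine (lev L k) M μ₀) ((i.1 + unitVec (fine (lev L k) M) μ) μ₀) with hc'
      have hcc : |c' - c| ≤ 2 * π / ((lev L k : ℕ) * (M μ₀ : ℝ)) := by
        by_cases hμ : μ = μ₀
        · subst hμ
          have e : (i.1 + unitVec (fine (lev L k) M) μ) μ = i.1 μ + 1 := by
            rw [Pi.add_apply, unitVec, Pi.single_eq_same]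
          rw [hc', hc, e]
          refine (abs_cang_add_one_sub_le _ _).trans (le_of_eq ?_)
          simp only [fine]; push_cast; ring
        · have e : (i.1 + unitVec (fine (lev L k) M) μ) μ₀ = i.1 μ₀ := by
            rw [Pi.add_apply, unitVec, Pi.single_eq_of_ne (Ne.symm hμ), add_zero]
          rw [hc', hc, e, sub_self, abs_zero]; positivity
      refine (norm_wexp_sub_wexp_le L hA hθ (abs_cang_le _ _) (abs_cang_le _ _) k k).trans ?_
      have hMμ : (0 : ℝ) < M μ₀ := by exact_mod_cast Nat.pos_of_ne_zero (NeZero.ne (M μ₀))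
      have h2 : |θ| * |c' - c| ≤ |θ| * (2 * π / ((lev L k : ℕ) * (M μ₀ : ℝ))) := mul_le_mul_of_nonneg_left hcc (abs_nonneg θ)
      refine (add_le_add le_rfl h2).trans (le_of_eq ?_)
      unfold betaW; field_simp; ring
    · rw [waveRg_ne L M A θ ν₀ μ₀ hν, waveRg_ne L M A θ ν₀ μ₀ hν, sub_self, smul_zero, norm_zero]
      exact div_nonneg (betaW_nonneg M θ μ₀) (Nat.cast_nonneg _)

omit hM in
/-- **NOT THE FLAT BACKGROUND**: at the origin of the torus the profile is `cos 0 = 1`, so for `A ≠ 0`, `‖A‖ ≤ 1`, `0 < |θ| < 1` the transporter in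
direction `ν₀` differs from the identity. [folklore] -/
theorem waveRg_zero_ne_one {A : Matrix o o ℂ} (hA0 : A ≠ 0) (hA : ‖A‖ ≤ 1) {θ : ℝ} (h0 : θ ≠ 0) (h1 : |θ| < 1) (ν₀ μ₀ : Fin d) (k : ℕ) :
    waveRg L M A θ ν₀ μ₀ k ν₀ 0 ≠ 1 := by
  have hc : cang (fine (lev L k) M μ₀) ((0 : Tor (fine (lev L k) M)) μ₀) = 1 := by
    unfold cang; rw [Pi.zero_apply, ZMod.val_zero, Nat.cast_zero, mul_zero, zero_div, Real.cos_zero]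
  rw [waveRg_self, hc, mul_one]
  intro h
  apply wexp_ne_zero L h0 h1 hA0 hA k
  rw [wexp, h, sub_self, smul_zero]

/-! ## §4 Node NE3's hypothesis SHAPE across the block hierarchy -/

/-- **NODE NE3's HYPOTHESIS SHAPE ON THE TRANSVERSE WAVE** (`‖A‖ ≤ 1`, `|θ| ≤ 1`, `ν₀ ≠ μ₀`):
`LocalRate (bgReadings (regClass (liftR (waveRg A θ ν₀ μ₀)))) (2θ² + 2π|θ|/M_{μ₀}) L⁻¹` — the child reading at `x′` (level `k+1`) and the parent reading at
`par x′` (level `k`) differ by `≤ βw/n_k` because the exponential's remainders are `O(θ²/n_k)` and the profiles read on nested blocks differ by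
`≤ 2π/(n_k M_{μ₀})` (`abs_cang_sub_cang_par_le`); fed through the owner's faithful adapter `NE2FromNE3.localRate_of_consistent` BY NAME.  A statement
about the SHAPE on this toy family ONLY; node NE3 for Bałaban's minimisers is OPEN and untouched. [folklore] -/
theorem localRate_wave {A : Matrix o o ℂ} (hA : ‖A‖ ≤ 1) {θ : ℝ} (hθ : |θ| ≤ 1) {ν₀ μ₀ : Fin d} (hνμ : ν₀ ≠ μ₀) :
    LocalRate (bgReadings L M (regClass L M (liftR L M (waveRg L M A θ ν₀ μ₀)))) (betaW M θ μ₀) ((L : ℝ)⁻¹) := by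
  refine localRate_of_consistent L M fun W hW k ν x' => ?_
  have hn0 : (0 : ℝ) < ((lev L k : ℕ) : ℝ) := lev_pos L k
  have hβ : 0 ≤ betaW M θ μ₀ / (lev L k : ℕ) := div_nonneg (betaW_nonneg M θ μ₀) (Nat.cast_nonneg _)
  rcases hW with rfl | hW
  · -- the connection tower
    by_cases hν : ν = ν₀
    · subst hν
      rw [connTower_wave_self, connTower_wave_self]
      have hpar : (parT (lev L k) L M x').1 μ₀ = par (lev L k) L M x'.1 μ₀ := rfl
      rw [hpar]
      refine (norm_wexp_sub_wexp_le L hA hθ (abs_cang_le _ _) (abs_cang_le _ _) k (k + 1)).trans ?_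
      have hcc := abs_cang_sub_cang_par_le L M (lev L k) x'.1 μ₀
      have hL1 : (1 : ℝ) ≤ L := by exact_mod_cast Nat.one_le_iff_ne_zero.mpr (NeZero.ne L)
      have hmono : ((lev L k : ℕ) : ℝ) ≤ ((lev L (k + 1) : ℕ) : ℝ) := by
        rw [lev_succ', Nat.cast_mul]; exact le_mul_of_one_le_left hn0.le hL1
      have hk1 : θ ^ 2 / ((lev L (k + 1) : ℕ) : ℝ) ≤ θ ^ 2 / ((lev L k : ℕ) : ℝ) :=
        div_le_div_of_nonneg_left (sq_nonneg θ) hn0 hmono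
      have hMμ : (0 : ℝ) < M μ₀ := by exact_mod_cast Nat.pos_of_ne_zero (NeZero.ne (M μ₀))
      have h2 : |θ| * |cang (fine (lev L (k + 1)) M μ₀) (x'.1 μ₀) - cang (fine (lev L k) M μ₀) (par (lev L k) L M x'.1 μ₀)|
          ≤ |θ| * (2 * π / ((lev L k : ℕ) * (M μ₀ : ℝ))) := mul_le_mul_of_nonneg_left hcc (abs_nonneg θ)
      calc θ ^ 2 / ((lev L (k + 1) : ℕ) : ℝ) + θ ^ 2 / ((lev L k : ℕ) : ℝ)
            + |θ| * |cang (fine (lev L (k + 1)) M μ₀) (x'.1 μ₀) - cang (fine (lev L k) M μ₀) (par (lev L k) L M x'.1 μ₀)|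
          ≤ θ ^ 2 / ((lev L k : ℕ) : ℝ) + θ ^ 2 / ((lev L k : ℕ) : ℝ) + |θ| * (2 * π / ((lev L k : ℕ) * (M μ₀ : ℝ))) :=
            add_le_add (add_le_add hk1 le_rfl) h2
        _ = betaW M θ μ₀ / (lev L k : ℕ) := by unfold betaW; field_simp; ring
    · rw [connTower_wave_ne L M A θ ν₀ μ₀ hν, connTower_wave_ne L M A θ ν₀ μ₀ hν, sub_self, norm_zero]
      exact hβ
  · -- the lattice-derivative tower: identically zero
    rw [Set.mem_singleton_iff] at hW
    subst hW
    rw [dconnTower_wave L M A θ ν₀ μ₀ hνμ, dconnTower_wave L M A θ ν₀ μ₀ hνμ, sub_self, norm_zero]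
    exact hβ

/-! ## §5 ROOT B's END on the wave -/

/-- **ROOT B's END ON THE TRANSVERSE WAVE, every other binder DISCHARGED** (`L ≥ 2`, `d ≥ 1`, `a′ > 0`, `‖A‖ ≤ 1`, `ν₀ ≠ μ₀`,
`|θ| + θ² ≤ η⋆`, `2θ² + 2π|θ|/M_{μ₀} ≤ η⋆`): for the `x`-DEPENDENT background `waveRg A θ ν₀ μ₀` the lifted King-averaged unit-lattice covariances
of `(Δ_a^{(k)} ⊗ 1 + P_k(waveRg …))⁻¹` — `P` the typed tier-B perturbation of ROOT B — CONVERGE with rate `L^{−k}`, by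
`NE2BalabanThreshold.balaban_final_rate_of_regular` with `hreg := regularTransporters_wave` (`α = |θ| + θ²`, `β = βw`), `hNE3 := localRate_wave`
(`C = βw`), `η := η⋆`.  NOT a statement about Bałaban's minimisers; NE2 NOT proved. [folklore] -/
theorem balaban_final_rate_wave (hL : 2 ≤ L) (hd : 1 ≤ d) {a' : ℝ} (ha' : 0 < a') {A : Matrix o o ℂ} (hA : ‖A‖ ≤ 1)
    {ν₀ μ₀ : Fin d} (hνμ : ν₀ ≠ μ₀) {θ : ℝ} (hθ : |θ| + θ ^ 2 ≤ etaStar o d a a') (hθβ : betaW M θ μ₀ ≤ etaStar o d a a') :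
    TowerLimitRate (fun k => Qlev L M k ⊗ₖ (1 : Matrix o o ℂ)) ((L : ℝ) ^ d)
      (fun k => (calDalev L M a ha k ⊗ₖ (1 : Matrix o o ℂ)
        + balabanPert L M a (liftR L M (waveRg L M A θ ν₀ μ₀))
            (gaugeSlot L M (waveRg L M A θ ν₀ μ₀) (QuT L M o (siteT L M (waveRg L M A θ ν₀ μ₀))) (Q1 L M o) a') k)⁻¹)
      (Cpert (kappaBs o d a (|θ| + θ ^ 2) (betaW M θ μ₀)
          (a * (epsR o d (|θ| + θ ^ 2) * (2 + epsR o d (|θ| + θ ^ 2)) * Cst d a)) (kappa4F d a a' (|θ| + θ ^ 2) (betaW M θ μ₀)))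
        (2 * d * Cst d a) (CJ d a)
        (C2Bs o d L a (|θ| + θ ^ 2) (betaW M θ μ₀) (betaW M θ μ₀)
          (a * C2gram (Cst d a) 1 (epsR o d (|θ| + θ ^ 2)) (2 * d * Cst d a) (CJ d a) (Cst d a)
            (CdeltaR o d a (|θ| + θ ^ 2) (theta0 d (|θ| + θ ^ 2) (betaNE3 o (betaW M θ μ₀)))))
          (C4F o d L a a' (|θ| + θ ^ 2) (betaW M θ μ₀) (betaW M θ μ₀))) 0 1) ((L : ℝ)⁻¹) := by
  have hη := etaStar_pos (o := o) (d := d) a ha.le ha'.le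
  have hθ1 : |θ| ≤ 1 := by
    have h := etaStar_le_half (o := o) (d := d) (a := a) ha'.le
    nlinarith [sq_nonneg θ, abs_nonneg θ]
  exact balaban_final_rate_of_regular L M a ha hL hd (regularTransporters_wave L M hA hθ1 ν₀ μ₀) (betaW_nonneg M θ μ₀)
    (localRate_wave L M hA hθ1 hνμ) ha' hθ hθβ le_rfl

/-- the amplitude at which both smallness conditions hold: `θw = η⋆/(2 + 2π/M_{μ₀})`. [folklore] -/
def thetaW (o : Type*) [Fintype o] (d : ℕ) (a a' : ℝ) (M : Fin d → ℕ) (μ₀ : Fin d) : ℝ :=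
  etaStar o d a a' / (2 + 2 * π / (M μ₀ : ℝ))

omit [NeZero L] [DecidableEq o] in
/-- `0 < θw ≤ η⋆/2 ≤ ¼`, and both smallness conditions of `balaban_final_rate_wave` hold at `θw`. [folklore] -/
theorem thetaW_small (ha0 : 0 ≤ a) {a' : ℝ} (ha' : 0 ≤ a') (μ₀ : Fin d) :
    0 < thetaW o d a a' M μ₀
      ∧ |thetaW o d a a' M μ₀| + thetaW o d a a' M μ₀ ^ 2 ≤ etaStar o d a a'
      ∧ betaW M (thetaW o d a a' M μ₀) μ₀ ≤ etaStar o d a a' := by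
  have hη := etaStar_pos (o := o) (d := d) a ha0 ha'
  have hη2 := etaStar_le_half (o := o) (d := d) (a := a) ha'
  have hMμ : (0 : ℝ) < M μ₀ := by exact_mod_cast Nat.pos_of_ne_zero (NeZero.ne (M μ₀))
  set K : ℝ := 2 + 2 * π / (M μ₀ : ℝ) with hK
  have hK0 : (0 : ℝ) ≤ 2 * π / (M μ₀ : ℝ) := by positivity
  have hK2 : 2 ≤ K := by rw [hK]; linarith
  have hKpos : 0 < K := by linarith
  set t : ℝ := thetaW o d a a' M μ₀ with ht
  have htdef : t = etaStar o d a a' / K := rfl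
  have ht0 : 0 < t := by rw [htdef]; positivity
  have htK : t * K = etaStar o d a a' := by rw [htdef]; field_simp
  have hthalf : t ≤ etaStar o d a a' / 2 := by
    rw [htdef]; exact div_le_div_of_nonneg_left hη.le (by norm_num) hK2
  have ht14 : t ≤ 1 / 4 := by linarith
  refine ⟨ht0, ?_, ?_⟩
  · rw [abs_of_pos ht0]; nlinarith
  · unfold betaW
    rw [abs_of_pos ht0]
    have e : 2 * t ^ 2 + 2 * π * t / (M μ₀ : ℝ) = t * (2 * t + 2 * π / (M μ₀ : ℝ)) := by ring
    rw [e]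
    calc t * (2 * t + 2 * π / (M μ₀ : ℝ)) ≤ t * K := by
          refine mul_le_mul_of_nonneg_left ?_ ht0.le
          rw [hK]; linarith
      _ = etaStar o d a a' := htK

/-- **THE UNCONDITIONAL `x`-DEPENDENT INSTANCE** (`L ≥ 2`, `d ≥ 1`, `a′ > 0`, `‖A‖ ≤ 1`, `ν₀ ≠ μ₀`): at the amplitude
`θw = η⋆/(2 + 2π/M_{μ₀}) > 0` ROOT B's END fires for the transverse wave with NO smallness hypothesis left.  NE2 NOT proved; nothing about `U_k(V)`.
[folklore] -/
theorem balaban_final_rate_wave_at (hL : 2 ≤ L) (hd : 1 ≤ d) {a' : ℝ} (ha' : 0 < a') {A : Matrix o o ℂ} (hA : ‖A‖ ≤ 1)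
    {ν₀ μ₀ : Fin d} (hνμ : ν₀ ≠ μ₀) :
    let θ : ℝ := thetaW o d a a' M μ₀
    TowerLimitRate (fun k => Qlev L M k ⊗ₖ (1 : Matrix o o ℂ)) ((L : ℝ) ^ d)
      (fun k => (calDalev L M a ha k ⊗ₖ (1 : Matrix o o ℂ)
        + balabanPert L M a (liftR L M (waveRg L M A θ ν₀ μ₀))
            (gaugeSlot L M (waveRg L M A θ ν₀ μ₀) (QuT L M o (siteT L M (waveRg L M A θ ν₀ μ₀))) (Q1 L M o) a') k)⁻¹)
      (Cpert (kappaBs o d a (|θ| + θ ^ 2) (betaW M θ μ₀)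
          (a * (epsR o d (|θ| + θ ^ 2) * (2 + epsR o d (|θ| + θ ^ 2)) * Cst d a)) (kappa4F d a a' (|θ| + θ ^ 2) (betaW M θ μ₀)))
        (2 * d * Cst d a) (CJ d a)
        (C2Bs o d L a (|θ| + θ ^ 2) (betaW M θ μ₀) (betaW M θ μ₀)
          (a * C2gram (Cst d a) 1 (epsR o d (|θ| + θ ^ 2)) (2 * d * Cst d a) (CJ d a) (Cst d a)
            (CdeltaR o d a (|θ| + θ ^ 2) (theta0 d (|θ| + θ ^ 2) (betaNE3 o (betaW M θ μ₀)))))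
          (C4F o d L a a' (|θ| + θ ^ 2) (betaW M θ μ₀) (betaW M θ μ₀))) 0 1) ((L : ℝ)⁻¹) := by
  intro θ
  obtain ⟨-, h1, h2⟩ := thetaW_small (o := o) (d := d) M a ha.le ha'.le μ₀
  exact balaban_final_rate_wave L M a ha hL hd ha' hA hνμ h1 h2

/-- and that instance is NOT flat (for `A ≠ 0`): `0 < θw < 1`. [folklore] -/
theorem waveRg_at_zero_ne_one (ha0 : 0 ≤ a) {a' : ℝ} (ha' : 0 ≤ a') {A : Matrix o o ℂ} (hA0 : A ≠ 0) (hA : ‖A‖ ≤ 1)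
    (ν₀ μ₀ : Fin d) (k : ℕ) : waveRg L M A (thetaW o d a a' M μ₀) ν₀ μ₀ k ν₀ 0 ≠ 1 := by
  obtain ⟨h0, h1, -⟩ := thetaW_small (o := o) (d := d) M a ha0 ha' μ₀
  have hη2 := etaStar_le_half (o := o) (d := d) (a := a) ha'
  refine waveRg_zero_ne_one L M hA0 hA (ne_of_gt h0) ?_ ν₀ μ₀ k
  nlinarith [sq_nonneg (thetaW o d a a' M μ₀), abs_nonneg (thetaW o d a a' M μ₀)]

end Summit.QuantumFields.BalabanUV.T4Continuum.NE2BalabanWaveWitness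

end
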